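import Summits.BirchSwinnertonDyer.BirchSwinnertonDyer.Theorems.CMKolyvaginAtInertTwoKolyvaginPrimeInertAtTwo
import Summits.BirchSwinnertonDyer.BirchSwinnertonDyer.Theorems.CMKolyvaginAtInertTwoReciprocityFamilyAtTwo
import HarnessLib

/-!
# Route `CMKolyvaginAtInertTwo`, crux `CMKolyvaginExactAtInertTwo` (stmt-BirchSwinnertonDyer-24277):
# the `τ`-part descent at `p = 2` from PRIME-LEVEL point data only — one package `{1, ℓ}` per
# Kolyvagin prime `ℓ` (the minimal shape of item (0b)₂¹), reciprocity DISCHARGED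

Seat `bsd-line-cmk2-p1` g9 (cell `bsd-print-cf2`); helper (`--supports stmt-BirchSwinnertonDyer-24277`).
THEOREMS ONLY (no definition, no named fact, no instance, no `sorry`); no item is closed; BSD is not
proved by this.

WHY. g6's `KolyvaginDescentTwo.conjAct_eq_self_of_mem_selmerGroup_two` (`…TauPartDescentAtTwo`, p608079)
takes the machine's point-system binder `hpoints` with FULL support: ONE package (`ε`, `τ`, `A m`, `P_m`
for all `m`) whose Euler-system clauses (Gross Props. 5.3, 6.2 (1), 6.2 (2)) are demanded at EVERY
square-free product `m` of Kolyvagin primes of `(2, 1)` — i.e. Kolyvagin's derivative classes at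
composite levels. Its proof uses the clauses at `m = 1` and at ONE prime `m = ℓ` (chosen by the
Čebotarev leaf at `2`). The pen's booking memo (`BOOKING-TARGET-H2-levelzero.md` v2 §2) accordingly
phrases the open DATA item (0b)₂¹ as "PointSystem-at-(2,1) data restricted to `n ∈ {1, ℓ}`, `ℓ` CM-inert
Kolyvagin of `(2,1)`". THIS FILE re-proves the `τ`-part descent from exactly that: for every Kolyvagin
prime `ℓ` of `(2, 1)` (Gross form) a package `hpoints ℓ` = ty2's `PointSystem N W K P 2 (· = ℓ) 1 hdiv c`
in Prop shape (support the single prime `ℓ`, so its `rel` clause speaks of `m ∈ {1, ℓ}` only; the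
packages for different `ℓ` need not share `ε`, `τ`, `A m`). The reciprocity binder `hRT` is kept in the
core statement (level written `q`, as in g6) and DISCHARGED in the habitat form by this seat's
`KolyvaginReciprocityTwo.nonempty_reciprocityFamily_conductorNorm` (p634537).

* `conjAct_eq_self_of_mem_selmerGroup_two_primeLevel` — g6's core with per-prime packages: `ρ̄_{E,2}` onto,
  `Δ_E < 0`, `Δ_E ∉ K²`, `K` imaginary quadratic with conjugation `c ≠ 1`, `P ∈ E(K)` Heegner of level
  `N` with `P ∉ 2E(K)`, per-prime `hpoints`, `hRT` ⟹ `c_* s = s` on `Sel₂(E/K)`. PROOF = g6's, with one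
  extra Čebotarev call: for `u = c_* s − s ≠ 0` the leaf (family `(u)`) first yields SOME Kolyvagin prime
  `ℓ₀`, whose package gives Gross 5.3 at `m = 1` and hence `c_* δ₂P = δ₂P`; then the leaf on `(u, δ₂P)`
  yields `ℓ` with `u_λ ≠ 0 ≠ (δ₂P)_λ`, and the package AT `ℓ` supplies `c(ℓ)` (`(−ε)`-eigen, Selmer off
  `λ`, not Selmer at `λ` by 6.2 (2)); leaf (B) at two (`lemma_5_3_descent_two`) forces `u_λ = 0`.
* `conjAct_eq_self_of_cmInert_primeLevel_two` — ON H₂ (`HasCM`, `CMInert W 2`, `ρ̄₂` onto, `W` globally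
  minimal; `K` Heegner for `N_E`): from ty2-structured per-prime DATA
  `D : ∀ ℓ, IsKolyvaginPrime N_E W K 2 ℓ → Frob → CMInert W ℓ → ∀ hdiv, PointSystem N_E W K P 2 (· = ℓ) 1 hdiv c`
  ALONE (reciprocity, `Δ < 0`, `Δ ∉ K²`, CM-inertness of Gross-form Kolyvagin primes all discharged):
  `c_* s = s` on `Sel₂(E/K)`.

Beyond print: NO (the odd-`p` argument of Gross §10 / McCallum §5 at `2` modulo the point data, as g6).
BSD is not proved by this.

References: [GrossLMS1991] Prop. 2.1 with §10, (4.4), Props. 5.3, 5.4, 6.2; [McCallumLMS1991] §2 Prop.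
2.2, §3 Cor. 3.2, §5 Lemma 5.3; `Cruxes/CMExactDescentAtTwo/MEMO-tau-line-at-two.md` §2.
-/

-- single-conjunct summit: `Summit.BirchSwinnertonDyer.BirchSwinnertonDyer.…` repeats the name by design
set_option linter.dupNamespace false
set_option autoImplicit false

noncomputable section

open scoped Classical
open WeierstrassCurve NumberField IsDedekindDomain Field
open Literature.NumberTheory.GaloisRepresentations Literature.NumberTheory.EllipticCurves
open Literature.NumberTheory.EllipticCurves.Rank1Residual

namespace Summit.BirchSwinnertonDyer.BirchSwinnertonDyer.Theorems.KolyvaginDescentTwo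

-- `K : Type` (universe 0) as in the Čebotarev leaf at `2` (p597930) and the route items
variable (W : WeierstrassCurve ℚ) {K : Type} [Field K] [NumberField K]

/-- **`τ = 1` on `Sel₂(E/K)` when `y_K ∉ 2E(K)`, from PRIME-LEVEL point packages** (one package per
Kolyvagin prime `ℓ` of `(2, 1)`, support `{ℓ}`: Gross (4.4), 5.3, 6.2 at `m ∈ {1, ℓ}` only) and the
pairing-form reciprocity `hRT` (level written `q`, `q = 2`; instantiate `q := 2 ^ 1`). See the module
docstring for the proof. [cite: GrossLMS1991, Prop. 2.1 with §10 (proof), (4.4), Props. 5.3, 6.2]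
[cite: McCallumLMS1991, §2 Prop. 2.2, §3 Cor. 3.2, §5 Lemma 5.3] -/
theorem conjAct_eq_self_of_mem_selmerGroup_two_primeLevel {N : ℕ} [NeZero N] [W.IsElliptic]
    (hK : IsImaginaryQuadratic K) {P : (W.baseChange K).toAffine.Point} (hP : IsHeegnerPoint N W K P)
    (hρ : W.HasSurjectiveModNGaloisRep 2) (hΔ : W.Δ < 0) (hΔK : ¬ IsSquare (W.baseChange K).Δ)
    {c : K ≃ₐ[ℚ] K} (hc : c ≠ 1) (hy : ∀ Q : (W.baseChange K).toAffine.Point, 2 • Q ≠ P)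
    {q : ℕ} (hq : q = 2)
    (hpoints : ∀ (hdiv : ∀ Q : geomPoints (W.baseChange K), ∃ R, (q : ℤ) • R = Q)
      ⦃ℓ : ℕ⦄ (_ : IsKolyvaginPrime N W K 2 ℓ), FrobEqFrobInfty W K q ℓ →
      ∃ (ε : ℤ) (τ : AlgebraicClosure K ≃+* AlgebraicClosure K) (hτ : IsLiftOfAut c τ)
        (A : ℕ → AddSubgroup (geomPoints (W.baseChange K)))
        (hA : ∀ m, KolyvaginCocycle.IsAdmissible (Field.absoluteGaloisGroup K) (A m) (q : ℤ))
        (Pt : ℕ → geomPoints (W.baseChange K))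
        (hPt : ∀ m, Pt m ∈ KolyvaginCocycle.invPoints (Field.absoluteGaloisGroup K) (A m) (q : ℤ)),
        (ε = 1 ∨ ε = -1) ∧
        IsOfFinAddOrder (Affine.Point.map (W' := W) (c : K →ₐ[ℚ] K) P - ε • P) ∧
        (∀ m, ∀ a ∈ A m, hτ.pointsMap W a ∈ A m) ∧
        Pt 1 = toGeomPoints (W.baseChange K) P ∧
        (∀ m : ℕ, Squarefree m →
          (∀ q' ∈ m.primeFactors, IsKolyvaginPrime N W K 2 q' ∧ FrobEqFrobInfty W K q q' ∧ q' = ℓ) →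
          (∃ B ∈ A m, hτ.pointsMap W (Pt m) =
            (ε * (-1) ^ m.primeFactors.card) • Pt m + (q : ℤ) • B) ∧
          (∀ v : HeightOneSpectrum (𝓞 K), (m : 𝓞 K) ∉ v.asIdeal →
            kolyvaginClass (W.baseChange K) _ hdiv (hA m) (Pt m) (hPt m) ∈
              selmerLocalKer (W.baseChange K) (v.adicCompletion K) (q : ℤ)) ∧
          (∀ ℓ' : ℕ, ℓ'.Prime → ℓ' ∣ m → ∀ v : HeightOneSpectrum (𝓞 K), (ℓ' : 𝓞 K) ∈ v.asIdeal →
            ∀ a : ℕ, ((((2 : ℕ) : ℤ) ^ a) •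
                kolyvaginClass (W.baseChange K) _ hdiv (hA m) (Pt m) (hPt m) ∈
                selmerLocalKer (W.baseChange K) (v.adicCompletion K) (q : ℤ) ↔
              (((2 : ℕ) : ℤ) ^ a) • kolyvaginClass (W.baseChange K) _ hdiv (hA (m / ℓ')) (Pt (m / ℓ'))
                  (hPt (m / ℓ')) ∈
                (W.baseChange K).torsionLocalKer (v.adicCompletion K) (q : ℤ)))))
    (hRT : ∀ {ℓ : ℕ} (hℓ : IsKolyvaginPrime N W K 2 ℓ), FrobEqFrobInfty W K q ℓ →
      ∃ (A : Type) (_ : AddCommGroup A)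
        (e : geomTorsion (W.baseChange K) (q : ℤ) →+ geomTorsion (W.baseChange K) (q : ℤ) →+ A),
        (∀ x, e x x = 0) ∧ (∀ x, (∀ y, e x y = 0) → x = 0) ∧
        ∀ (T : Finset (HeightOneSpectrum (𝓞 K))),
        ∀ s ∈ selmerGroup (W.baseChange K) (q : ℤ),
          (∀ v ∈ T, s ∈ (W.baseChange K).torsionLocalKer (v.adicCompletion K) (q : ℤ)) →
          ∀ c' : galH1Torsion (W.baseChange K) (q : ℤ),
          (∀ v : HeightOneSpectrum (𝓞 K), v ∉ T → (ℓ : 𝓞 K) ∉ v.asIdeal →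
            c' ∈ selmerLocalKer (W.baseChange K) (v.adicCompletion K) (q : ℤ)) →
          (∀ w : InfinitePlace K, c' ∈ selmerLocalKer (W.baseChange K) w.Completion (q : ℤ)) →
          ∀ 𝔔 ∈ hℓ.place.primesAbove, ∀ F : Field.absoluteGaloisGroup K,
            IsArithFrobAt (𝓞 K) F 𝔔 → F ∈ torsionFixing (W.baseChange K) (q : ℤ) →
            ∀ σ ∈ 𝔔.inertia (Field.absoluteGaloisGroup K),
            e (h1Eval (W.baseChange K) (q : ℤ) s F) (h1Eval (W.baseChange K) (q : ℤ) c' σ) = 0) :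
    ∀ s ∈ selmerGroup (W.baseChange K) (q : ℤ), conjAct W c (q : ℤ) s = s := by
  subst hq
  classical
  haveI : Fact (Nat.Prime 2) := ⟨Nat.prime_two⟩
  haveI : Algebra.IsQuadraticExtension ℚ K := ⟨hK.1⟩
  haveI : IsTotallyComplex K := hK.2
  intro s hs
  have hdiv : ∀ Q : geomPoints (W.baseChange K), ∃ R, (((2 : ℕ) : ℕ) : ℤ) • R = Q :=
    (W.baseChange K).zsmul_geomPoints_surjective_holds (by norm_num)
  -- ### `2 · H¹(K, E₂) = 0`
  have h2 : ∀ z : galH1Torsion (W.baseChange K) (((2 : ℕ) : ℕ) : ℤ), z + z = 0 := fun z ↦ by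
    have h : (2 : ℤ) • z = 0 := zsmul_galH1Torsion_eq_zero (W.baseChange K) _ z
    rwa [two_zsmul] at h
  have hneg : ∀ z : galH1Torsion (W.baseChange K) (((2 : ℕ) : ℕ) : ℤ), -z = z := fun z ↦
    neg_eq_of_add_eq_zero_left (h2 z)
  -- ### `x = δ₂ y_K ≠ 0` (as `y_K ∉ 2E(K)`)
  set x : galH1Torsion (W.baseChange K) (((2 : ℕ) : ℕ) : ℤ) := kummerMapTorsion (W.baseChange K) _ hdiv P
    with hx_def
  have hx0 : x ≠ 0 := by
    intro h0
    have hker : P ∈ (kummerMapTorsion (W.baseChange K) _ hdiv).ker := by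
      rw [AddMonoidHom.mem_ker, ← hx_def, h0]
    rw [kummerMapTorsion_ker, AddMonoidHom.mem_range] at hker
    obtain ⟨R, hR⟩ := hker
    refine hy R ?_
    have hR' : (((2 : ℕ) : ℕ) : ℤ) • R = P := hR
    rwa [natCast_zsmul] at hR'
  -- ### a package at any Kolyvagin prime computes `c(1) = δ₂ y_K` and gives `c_* x = x`
  have hpack1 : ∀ ⦃ℓ : ℕ⦄ (hℓ : IsKolyvaginPrime N W K 2 ℓ), FrobEqFrobInfty W K 2 ℓ →
      conjAct W c _ x = x := by
    intro ℓ hℓ hF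
    obtain ⟨ε, τ, hτ, A, hA, Pt, hPt, hε, -, hAτ, hPt1, hrel⟩ := hpoints hdiv hℓ hF
    have hP1 : toGeomPoints (W.baseChange K) P ∈
        KolyvaginCocycle.invPoints (Field.absoluteGaloisGroup K) (A 1) (((2 : ℕ) : ℕ) : ℤ) := by
      rw [← hPt1]; exact hPt 1
    have hc1 : kolyvaginClass (W.baseChange K) _ hdiv (hA 1) (Pt 1) (hPt 1) = x := by
      rw [KolyvaginDescent.kolyvaginClass_congr_point (hA 1) (hP' := hP1) hPt1]
      exact kolyvaginClass_toGeomPoints (hA 1) P hP1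
    have hone : ∀ q' ∈ (1 : ℕ).primeFactors,
        IsKolyvaginPrime N W K 2 q' ∧ FrobEqFrobInfty W K 2 q' ∧ q' = ℓ :=
      fun q' hq' ↦ absurd hq' (by simp)
    have h := conjAct_kolyvaginClass_eq_smul W (hdiv := hdiv) hτ (hA 1) (hAτ 1) (hPt 1) _
      (hrel 1 squarefree_one hone).1
    rw [hc1, Nat.primeFactors_one, Finset.card_empty, pow_zero, mul_one] at h
    rcases hε with rfl | rfl
    · rwa [one_smul] at h
    · rwa [neg_one_zsmul, hneg] at h
  -- ### suppose `u = c_* s − s ≠ 0`; `c_* u = −u = u`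
  by_contra hne
  have hcard : Nat.card (K ≃ₐ[ℚ] K) = 2 := by rw [IsGalois.card_aut_eq_finrank, hK.1]
  have hcc : c * c = 1 := by
    have h := pow_card_eq_one' (G := K ≃ₐ[ℚ] K) (x := c)
    rwa [hcard, pow_two] at h
  have hu0 : conjAct W c _ s - s ≠ 0 := fun h ↦ hne (sub_eq_zero.mp h)
  have hτu : conjAct W c _ (conjAct W c _ s - s) = conjAct W c _ s - s := by
    rw [map_sub, conjAct_conjAct_of_mul_self W hcc, ← neg_sub, hneg]
  have hC := Literature.NumberTheory.Automorphic.chebotarev_artinRep_holds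
  -- ### a first Kolyvagin prime `ℓ₀` (Čebotarev on the family `(u)`), only to get `c_* x = x`
  have hx1 : conjAct W c _ x = x := by
    obtain ⟨ℓ₀, -, hℓ, hℓN, hℓD, hℓ2, hprime, hfrob, -⟩ :=
      KolyvaginImageTwo.exists_kolyvaginPrime_gt_two hC (N := N) W hK hρ hΔ hΔK hc ![conjAct W c _ s - s]
        (fun i ↦ by fin_cases i; exact hτu) (fun _ ↦ 1) (fun _ ↦ le_rfl)
        (dvd_two_of_sum_one h2 hu0) 0
    exact hpack1 ⟨hℓ, hℓN, hℓD, hℓ2, hprime, hfrob⟩ hfrob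
  -- ### Čebotarev at `2`: a Kolyvagin prime `ℓ` of `(2, 1)` with `u_λ ≠ 0` and `x_λ ≠ 0`
  obtain ⟨ℓ, hℓK, hux⟩ : ∃ ℓ : ℕ, IsKolyvaginPrime N W K 2 ℓ ∧
      ∀ v : HeightOneSpectrum (𝓞 K), (ℓ : 𝓞 K) ∈ v.asIdeal →
        conjAct W c _ s - s ∉
            (W.baseChange K).torsionLocalKer (v.adicCompletion K) (((2 : ℕ) : ℕ) : ℤ) ∧
          x ∉ (W.baseChange K).torsionLocalKer (v.adicCompletion K) (((2 : ℕ) : ℕ) : ℤ) := by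
    by_cases hux : conjAct W c _ s - s = x
    · -- family `(x)`
      obtain ⟨ℓ, -, hℓ, hℓN, hℓD, hℓ2, hprime, hfrob, hloc⟩ :=
        KolyvaginImageTwo.exists_kolyvaginPrime_gt_two hC (N := N) W hK hρ hΔ hΔK hc ![x]
          (fun i ↦ by fin_cases i; exact hx1) (fun _ ↦ 1) (fun _ ↦ le_rfl)
          (dvd_two_of_sum_one h2 hx0) 0
      refine ⟨ℓ, ⟨hℓ, hℓN, hℓD, hℓ2, hprime, hfrob⟩, fun v hv ↦ ?_⟩
      have h1 := hloc 0 v hv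
      simp only [Matrix.cons_val_zero, one_ne_zero, iff_false] at h1
      exact ⟨hux ▸ h1, h1⟩
    · -- family `(u, x)`
      obtain ⟨ℓ, -, hℓ, hℓN, hℓD, hℓ2, hprime, hfrob, hloc⟩ :=
        KolyvaginImageTwo.exists_kolyvaginPrime_gt_two hC (N := N) W hK hρ hΔ hΔK hc
          ![conjAct W c _ s - s, x]
          (fun i ↦ by fin_cases i; exacts [hτu, hx1]) (fun _ ↦ 1) (fun _ ↦ le_rfl)
          (dvd_two_of_sum_two h2 hu0 hx0 hux) 0
      refine ⟨ℓ, ⟨hℓ, hℓN, hℓD, hℓ2, hprime, hfrob⟩, fun v hv ↦ ?_⟩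
      have h0 := hloc 0 v hv
      have h1 := hloc 1 v hv
      simp only [Matrix.cons_val_zero, Matrix.cons_val_one, one_ne_zero, iff_false] at h0 h1
      exact ⟨h0, h1⟩
  have hfrob1 : FrobEqFrobInfty W K 2 ℓ := hℓK.2.2.2.2.2
  have hℓprime : ℓ.Prime := hℓK.prime
  -- ### THE PACKAGE AT `ℓ`: classes `c(m)`, `c(1) = δ₂ y_K = x`
  obtain ⟨ε, τ, hτ, A, hA, Pt, hPt, hε, -, hAτ, hPt1, hrel⟩ := hpoints hdiv hℓK hfrob1
  -- (`cl` kept OPAQUE: a transparent `set` lets the unifier unfold `kolyvaginClass` and time out)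
  obtain ⟨cl, hcl⟩ : ∃ cl : ℕ → galH1Torsion (W.baseChange K) (((2 : ℕ) : ℕ) : ℤ),
      ∀ m, cl m = kolyvaginClass (W.baseChange K) _ hdiv (hA m) (Pt m) (hPt m) := ⟨_, fun _ ↦ rfl⟩
  have hP1 : toGeomPoints (W.baseChange K) P ∈
      KolyvaginCocycle.invPoints (Field.absoluteGaloisGroup K) (A 1) (((2 : ℕ) : ℕ) : ℤ) := by
    rw [← hPt1]; exact hPt 1
  have hc1 : cl 1 = x := by
    rw [hcl 1, KolyvaginDescent.kolyvaginClass_congr_point (hA 1) (hP' := hP1) hPt1]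
    exact kolyvaginClass_toGeomPoints (hA 1) P hP1
  -- ### Kolyvagin's class `d = c(ℓ)`: `(−ε)`-eigen, Selmer off `ℓ` and at `∞`, NOT Selmer at `λ`
  have hkol : ∀ q' ∈ ℓ.primeFactors,
      IsKolyvaginPrime N W K 2 q' ∧ FrobEqFrobInfty W K 2 q' ∧ q' = ℓ := by
    intro q' hq'
    rw [hℓprime.primeFactors, Finset.mem_singleton] at hq'
    subst hq'
    exact ⟨hℓK, hfrob1, rfl⟩
  obtain ⟨h541, hdsel, hdloc⟩ := hrel ℓ hℓprime.squarefree hkol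
  have hdeig : conjAct W c _ (cl ℓ) = (ε * (-1) ^ ℓ.primeFactors.card) • cl ℓ := by
    rw [hcl ℓ]
    exact conjAct_kolyvaginClass_eq_smul W (hdiv := hdiv) hτ (hA ℓ) (hAτ ℓ) (hPt ℓ) _ h541
  have hdsel' : ∀ v : HeightOneSpectrum (𝓞 K), (ℓ : 𝓞 K) ∉ v.asIdeal →
      cl ℓ ∈ selmerLocalKer (W.baseChange K) (v.adicCompletion K) (((2 : ℕ) : ℕ) : ℤ) := fun v hv ↦ by
    rw [hcl ℓ]; exact hdsel v hv
  have hdloc' : cl ℓ ∈ selmerLocalKer (W.baseChange K) (hℓK.place.adicCompletion K) (((2 : ℕ) : ℕ) : ℤ) ↔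
      cl (ℓ / ℓ) ∈ (W.baseChange K).torsionLocalKer (hℓK.place.adicCompletion K) (((2 : ℕ) : ℕ) : ℤ) := by
    have h := hdloc ℓ hℓprime dvd_rfl hℓK.place hℓK.mem_place 0
    rw [pow_zero, one_smul, one_smul, ← hcl ℓ, ← hcl (ℓ / ℓ)] at h
    exact h
  rw [Nat.div_self hℓprime.pos, hc1] at hdloc'
  have hν : ε * (-1) ^ ℓ.primeFactors.card = 1 ∨ ε * (-1) ^ ℓ.primeFactors.card = -1 := by
    rw [hℓprime.primeFactors, Finset.card_singleton, pow_one]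
    rcases hε with rfl | rfl <;> simp
  have hdv : cl ℓ ∉ selmerLocalKer (W.baseChange K) (hℓK.place.adicCompletion K) (((2 : ℕ) : ℕ) : ℤ) :=
    fun hmem ↦ (hux hℓK.place hℓK.mem_place).2 (hdloc'.mp hmem)
  have hdinf : ∀ w : InfinitePlace K,
      cl ℓ ∈ selmerLocalKer (W.baseChange K) w.Completion (((2 : ℕ) : ℕ) : ℤ) := fun w ↦ by
    haveI : IsAlgClosed w.Completion := isAlgClosed_of_ringEquiv
      (InfinitePlace.Completion.ringEquivComplexOfIsComplex (IsTotallyComplex.isComplex w)).symm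
    rw [WeierstrassCurve.selmerLocalKer_eq_top_of_isAlgClosed]
    trivial
  have hgood : (W.baseChange K).HasGoodReductionAt hℓK.place := by
    have h := IsKolyvaginPrime.not_mem_badPlaces (W := W) hP hℓK
    rwa [WeierstrassCurve.mem_badPlaces_iff, not_not] at h
  -- ### leaf (B) at two: `(c_* s − s)_λ = 0` — contradiction
  obtain ⟨B, _, e, halt, hnd, hRe⟩ := hRT hℓK hfrob1
  have hfin := lemma_5_3_descent_two W hK hc hℓK (q := 2) rfl hfrob1 hgood e halt hnd hν hdeig hdv hs
    (fun 𝔔 h𝔔 F hF hFT σ hσ ↦ hRe ∅ s hs (fun _ h ↦ absurd h (Finset.notMem_empty _)) (cl ℓ)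
      (fun v _ hv ↦ hdsel' v hv) hdinf 𝔔 h𝔔 F hF hFT σ hσ)
  exact (hux hℓK.place hℓK.mem_place).1 hfin

/-! ## On the habitat H₂: ty2-structured per-prime DATA, everything else discharged -/

/-- **The `τ`-part descent ON H₂ from PRIME-LEVEL DATA ALONE.** `W/ℚ` globally minimal with CM,
`CMInert W 2`, `ρ̄_{W,2}` onto; `K` imaginary quadratic with the Heegner hypothesis for `N_E` and
conjugation `c ≠ 1`; `P ∈ E(K)` a Heegner point of level `N_E` with `P ∉ 2E(K)`. GIVEN, for every
Kolyvagin prime `ℓ` of `(2, 1)` that is CM-inert, ty2's point-system datum at level `2 = 2^1` with support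
the single prime `ℓ` (levels `m ∈ {1, ℓ}`; item (0b)₂¹ in its minimal shape): **`c_* s = s` on
`Sel₂(E/K)`**. Discharged here: `Δ_E < 0` (p591040), `Δ_E ∉ K²` (p596346), CM-inertness of Gross-form
Kolyvagin primes of `(2, 1)` (g6 p609668) and the reciprocity family (g9 p634537).
[cite: GrossLMS1991, Prop. 2.1 with §10 (proof), (4.4), Props. 5.3, 6.2]
[cite: McCallumLMS1991, §2 Prop. 2.2, §5 Lemma 5.3] -/
theorem conjAct_eq_self_of_cmInert_primeLevel_two [W.IsElliptic] [W.IsGloballyMinimal]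
    [NeZero (W.conductorNorm ℤ)] (hCM : W.HasCM) (hin : CMInert W 2) (hsurj : W.HasSurjectiveModNGaloisRep 2)
    (hK : IsImaginaryQuadratic K) (hH : SatisfiesHeegnerHypothesis (W.conductorNorm ℤ) K)
    {P : (W.baseChange K).toAffine.Point} (hP : IsHeegnerPoint (W.conductorNorm ℤ) W K P)
    {c : K ≃ₐ[ℚ] K} (hc : c ≠ 1) (hy : ∀ Q : (W.baseChange K).toAffine.Point, 2 • Q ≠ P)
    (D : ∀ ⦃ℓ : ℕ⦄ (_ : IsKolyvaginPrime (W.conductorNorm ℤ) W K 2 ℓ), FrobEqFrobInfty W K (2 ^ 1) ℓ →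
      CMInert W ℓ → ∀ hdiv : ∀ Q : geomPoints (W.baseChange K), ∃ R, ((2 ^ 1 : ℕ) : ℤ) • R = Q,
      Rank1Residual.P2.KolyvaginMachine.PointSystem (W.conductorNorm ℤ) W K P 2 (fun q ↦ q = ℓ) 1 hdiv c) :
    ∀ s ∈ selmerGroup (W.baseChange K) ((2 ^ 1 : ℕ) : ℤ), conjAct W c ((2 ^ 1 : ℕ) : ℤ) s = s := by
  have hΔ : W.Δ < 0 := KolyvaginEigenTwo.Δ_neg_of_cmInert_two W hCM hin hsurj
  have hΔK : ¬ IsSquare (W.baseChange K).Δ := by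
    have h : (W.baseChange K).Δ = algebraMap ℚ K W.Δ := by rw [baseChange, map_Δ]
    rw [h]
    exact KolyvaginImageTwo.not_isSquare_algebraMap_Δ_of_cmInert_two_of_heegner W hCM hin hsurj K hK hH
  obtain ⟨R⟩ := KolyvaginReciprocityTwo.nonempty_reciprocityFamily_conductorNorm W K Nat.prime_two
    (fun _ ↦ True)
  refine conjAct_eq_self_of_mem_selmerGroup_two_primeLevel W hK hP hsurj hΔ hΔK hc hy (q := 2 ^ 1)
    (pow_one 2) ?_ ?_
  · intro hdiv ℓ hℓ hF
    set D' := D hℓ hF (cmInert_of_isKolyvaginPrime_two W hCM hin hsurj hℓ) hdiv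
    exact ⟨D'.ε, D'.τ, D'.hτ, D'.A, D'.hA, D'.Pt, D'.hPt, D'.hε, D'.conj_sub_torsion, D'.A_stable,
      D'.Pt_one, D'.rel⟩
  · intro ℓ hℓ hF
    exact Rank1Residual.P2.KolyvaginMachine.hRT_of_reciprocityFamily R le_rfl hℓ hF trivial

end Summit.BirchSwinnertonDyer.BirchSwinnertonDyer.Theorems.KolyvaginDescentTwo

end
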